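import Literature.Geometry.ComplexAnalytic.EquivariantA3NormalForm
import HarnessLib

/-!
# The `A₃` chart of the d6 pencil on the μ₄×μ₂ branch chart of the quaternionic quartic family (brick L6-2, instance)

Family `hodge`, layer `Literature/AlgebraicGeometry/HodgeTheory`; theorems only (no definition, no named fact). Written by the
prover seat `hodge-nonav-prover-Bx` (g21, cell `hodge-nonav`), programme «BRANCH CHART» (memo `HOME/memos/S5-GLOBAL-ARCHITECTURE-Bx-g21.md`
§2), for crux K1Q `VeryGeneralQuaternionCommutatorsInHg` of `Summits/HodgeConjecture/HodgeConjecture/Theses/Q8SymplecticPowers.lean`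
(stmt-HodgeConjecture-24190; stub S9, S5-half; Ax's bricks L6-3/L6-5 consume the chart).

SETTING (affine chart `x₂ = 1`, plane coordinates `u = (u₀,u₁)`). The quaternionic quartic multiple plane is `w⁴ = c·σc³·α²·ψ²` with
`c(u) = a₀u₀ + a₁u₁ + a₂`, `σc(u) = a₁u₀ + a₀u₁ + a₂`, `α(u) = u₀ − u₁`, `ψ` σ-symmetric of degree `e − 1` (here: any function analytic at
the point). Over `σc·α ≠ 0` its normalisation is the `ι`-quotient of the μ₄×μ₂ BRANCH CHART `{s⁴ = c·σc³, y² = α·ψ}` (`w = sy`,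
`w₁ = s²/σc`, `w₂ = s³y/σc²` recover the tree's `Q8Family.DeckRing` on `c·ψ ≠ 0`; `ι(s,y) = (−s,−y)`, deck `τ̃(s) = i·s`). Moving the
constant coefficient of `ψ` (the pencil `ψ ↦ ψ + ε·x₂^{e−1}`, a line in the parameter space) has total space the 3-fold
`M = {s⁴ = c·σc³} × ℂ_y` with pencil coordinate `ε(u,s,y) = y²/α(u) − ψ(u)`. When `a₀² ≠ a₁²` the affine map `u ↦ (c(u), σc(u))` has the
inverse `L`, and on `M ∩ {σc ≠ 0}` one has `c = s⁴/σc³`, so `(y, m, s) ↦ (L(s⁴/m³, m), s, y)` are global coordinates on `M ∩ {σc ≠ 0}`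
(`mem_branchTotalSpace_of_coordinates`) in which `ε = y²/α(L(s⁴/m³,m)) − ψ(L(s⁴/m³,m))`.

THEOREM (`exists_branchPencil_A3Chart`). At a d6 point — `c` SIMPLY TANGENT to the level curve of `ψ` at `p = L(0, m₀)` (`m₀ = σc(p) ≠ 0`,
`α(p) ≠ 0`): `∂_m ψ(L(0,m))|_{m₀} = 0`, `∂²_m ψ(L(0,m))|_{m₀} ≠ 0`, and `∂_c ψ(L(c,m₀))|_{0} ≠ 0` (`∇ψ(p) ≠ 0`) — the pencil coordinate has
the EQUIVARIANT `A₃` normal form of `EquivariantA3NormalForm.exists_equivariantA3Chart`: a holomorphic chart `Θ` of `ℂ³` at `(0, m₀, 0)`,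
real `C^∞` with `C^∞` inverse, with `(Θ z)₀² + (Θ z)₁² + (Θ z)₂⁴ = ε(z) − ε(z₀)` on a polydisc and `Θ ∘ diag(ε₀,1,ε₂) = diag(ε₀,1,ε₂) ∘ Θ`
for `‖ε₀‖ = 1`, `ε₂⁴ = 1` — in particular for the covering involution `ι = diag(−1,1,−1)` (= `PhamBrieskornA3Involution.iotaFibre`) and the
deck generator `τ̃ = diag(1,1,i)` (the model deck `z₂ ↦ ζ₄z₂` of the Pham–Brieskorn fibre with exponents `(2,2,4)`).

Honest scope: a local coordinate change on an explicit 3-fold; nothing here says HC or K1Q is proved.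

## References

* [ArnoldGuseinZadeVarchenko1985] AGZV I, §9.6 and §11.1 (`A₃`).
* [Milnor1968] J. Milnor, *Singular Points of Complex Hypersurfaces*, §9.
* [Kollar2007] J. Kollár, *Lectures on Resolution of Singularities* (2007), §3.3 (the family's equation).
-/

noncomputable section

open Filter Set Metric Complex Topology
open scoped ContDiff

namespace Literature.AlgebraicGeometry.HodgeTheory.Q8Family.BranchChart

open Literature.Geometry.ComplexAnalytic.EquivariantA3 Literature.Geometry.ComplexAnalytic.ParametricMorse

variable (a₀ a₁ a₂ : ℂ)

/-- `c ∘ L = pr₁` for the inverse `L` of `u ↦ (c(u), σc(u))` (`a₀² ≠ a₁²`). [cite: Kollar2007, §3.3] -/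
theorem c_comp_inv (ha : a₀ ^ 2 ≠ a₁ ^ 2) (v : ℂ × ℂ) :
    let L : ℂ × ℂ → ℂ × ℂ := fun v =>
      ((a₀ * (v.1 - a₂) - a₁ * (v.2 - a₂)) / (a₀ ^ 2 - a₁ ^ 2), (a₀ * (v.2 - a₂) - a₁ * (v.1 - a₂)) / (a₀ ^ 2 - a₁ ^ 2))
    a₀ * (L v).1 + a₁ * (L v).2 + a₂ = v.1 := by
  intro L
  have h : a₀ ^ 2 - a₁ ^ 2 ≠ 0 := sub_ne_zero.2 ha
  simp only [L]
  field_simp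
  ring

/-- `σc ∘ L = pr₂` for the inverse `L` of `u ↦ (c(u), σc(u))` (`a₀² ≠ a₁²`). [cite: Kollar2007, §3.3] -/
theorem σc_comp_inv (ha : a₀ ^ 2 ≠ a₁ ^ 2) (v : ℂ × ℂ) :
    let L : ℂ × ℂ → ℂ × ℂ := fun v =>
      ((a₀ * (v.1 - a₂) - a₁ * (v.2 - a₂)) / (a₀ ^ 2 - a₁ ^ 2), (a₀ * (v.2 - a₂) - a₁ * (v.1 - a₂)) / (a₀ ^ 2 - a₁ ^ 2))
    a₁ * (L v).1 + a₀ * (L v).2 + a₂ = v.2 := by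
  intro L
  have h : a₀ ^ 2 - a₁ ^ 2 ≠ 0 := sub_ne_zero.2 ha
  simp only [L]
  field_simp
  ring

/-- **Global coordinates on the branch total space.** For `m ≠ 0` the point `u = L(s⁴/m³, m)` satisfies the branch equation
`s⁴ = c(u)·σc(u)³` with `σc(u) = m`: `(y, m, s)` parametrise `M ∩ {σc ≠ 0}`, `M = {s⁴ = c·σc³} × ℂ_y`. [cite: Kollar2007, §3.3] -/
theorem mem_branchTotalSpace_of_coordinates (ha : a₀ ^ 2 ≠ a₁ ^ 2) {m : ℂ} (hm : m ≠ 0) (s : ℂ) :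
    let L : ℂ × ℂ → ℂ × ℂ := fun v =>
      ((a₀ * (v.1 - a₂) - a₁ * (v.2 - a₂)) / (a₀ ^ 2 - a₁ ^ 2), (a₀ * (v.2 - a₂) - a₁ * (v.1 - a₂)) / (a₀ ^ 2 - a₁ ^ 2))
    let u := L (s ^ 4 / m ^ 3, m)
    (a₀ * u.1 + a₁ * u.2 + a₂) * (a₁ * u.1 + a₀ * u.2 + a₂) ^ 3 = s ^ 4 ∧ a₁ * u.1 + a₀ * u.2 + a₂ = m := by
  intro L u
  have h1 := c_comp_inv a₀ a₁ a₂ ha (s ^ 4 / m ^ 3, m)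
  have h2 := σc_comp_inv a₀ a₁ a₂ ha (s ^ 4 / m ^ 3, m)
  simp only at h1 h2
  refine ⟨?_, h2⟩
  show (a₀ * u.1 + a₁ * u.2 + a₂) * (a₁ * u.1 + a₀ * u.2 + a₂) ^ 3 = s ^ 4
  rw [show a₀ * u.1 + a₁ * u.2 + a₂ = s ^ 4 / m ^ 3 from h1, show a₁ * u.1 + a₀ * u.2 + a₂ = m from h2]
  field_simp

/-- `L ∘ (c, σc) = id`: `L` is a left inverse of `u ↦ (c(u), σc(u))` (`a₀² ≠ a₁²`). [cite: Kollar2007, §3.3] -/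
theorem inv_comp (ha : a₀ ^ 2 ≠ a₁ ^ 2) (u : ℂ × ℂ) :
    let L : ℂ × ℂ → ℂ × ℂ := fun v =>
      ((a₀ * (v.1 - a₂) - a₁ * (v.2 - a₂)) / (a₀ ^ 2 - a₁ ^ 2), (a₀ * (v.2 - a₂) - a₁ * (v.1 - a₂)) / (a₀ ^ 2 - a₁ ^ 2))
    L (a₀ * u.1 + a₁ * u.2 + a₂, a₁ * u.1 + a₀ * u.2 + a₂) = u := by
  intro L
  have h : a₀ ^ 2 - a₁ ^ 2 ≠ 0 := sub_ne_zero.2 ha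
  refine Prod.ext ?_ ?_
  · simp only [L]
    field_simp
    ring
  · simp only [L]
    field_simp
    ring

/-- Conversely every point `u` of the plane with `σc(u) = m ≠ 0` and `c(u)·σc(u)³ = s⁴` is `L(s⁴/m³, m)`. [cite: Kollar2007, §3.3] -/
theorem coordinates_of_mem_branchTotalSpace (ha : a₀ ^ 2 ≠ a₁ ^ 2) {u : ℂ × ℂ} {m s : ℂ} (hm : m ≠ 0)
    (hσ : a₁ * u.1 + a₀ * u.2 + a₂ = m) (hM : (a₀ * u.1 + a₁ * u.2 + a₂) * (a₁ * u.1 + a₀ * u.2 + a₂) ^ 3 = s ^ 4) :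
    let L : ℂ × ℂ → ℂ × ℂ := fun v =>
      ((a₀ * (v.1 - a₂) - a₁ * (v.2 - a₂)) / (a₀ ^ 2 - a₁ ^ 2), (a₀ * (v.2 - a₂) - a₁ * (v.1 - a₂)) / (a₀ ^ 2 - a₁ ^ 2))
    u = L (s ^ 4 / m ^ 3, m) := by
  intro L
  have hc : a₀ * u.1 + a₁ * u.2 + a₂ = s ^ 4 / m ^ 3 := by
    rw [hσ] at hM
    exact eq_div_of_mul_eq (pow_ne_zero 3 hm) hM
  have h := inv_comp a₀ a₁ a₂ ha u
  simp only at h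
  rw [hc, hσ] at h
  exact h.symm

/-- **The `A₃` chart of the d6 pencil on the branch chart** (module docstring). [cite: ArnoldGuseinZadeVarchenko1985, §9.6 and §11.1]
[cite: Milnor1968, §9] -/
theorem exists_branchPencil_A3Chart {ψ : ℂ × ℂ → ℂ} {m₀ : ℂ} (hm₀ : m₀ ≠ 0) :
    let L : ℂ × ℂ → ℂ × ℂ := fun v =>
      ((a₀ * (v.1 - a₂) - a₁ * (v.2 - a₂)) / (a₀ ^ 2 - a₁ ^ 2), (a₀ * (v.2 - a₂) - a₁ * (v.1 - a₂)) / (a₀ ^ 2 - a₁ ^ 2))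
    (L (0, m₀)).1 - (L (0, m₀)).2 ≠ 0 → AnalyticAt ℂ ψ (L (0, m₀)) →
    deriv (fun m => ψ (L (0, m))) m₀ = 0 → iteratedDeriv 2 (fun m => ψ (L (0, m))) m₀ ≠ 0 →
    deriv (fun c => ψ (L (c, m₀))) 0 ≠ 0 →
    ∃ Θ : OpenPartialHomeomorph (Fin 3 → ℂ) (Fin 3 → ℂ),
      (Pi.single 1 m₀ : Fin 3 → ℂ) ∈ Θ.source ∧ Θ (Pi.single 1 m₀) = 0 ∧
      DifferentiableOn ℂ Θ Θ.source ∧ ContDiffOn ℝ ∞ Θ Θ.source ∧ ContDiffOn ℝ ∞ Θ.symm Θ.target ∧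
      (∀ z ∈ Θ.source, Θ z 0 ^ 2 + Θ z 1 ^ 2 + Θ z 2 ^ 4 =
        (z 0 ^ 2 / ((L (z 2 ^ 4 / z 1 ^ 3, z 1)).1 - (L (z 2 ^ 4 / z 1 ^ 3, z 1)).2) - ψ (L (z 2 ^ 4 / z 1 ^ 3, z 1))) -
          (0 - ψ (L (0, m₀)))) ∧
      (∀ ε₀ ε₂ : ℂ, ‖ε₀‖ = 1 → ε₂ ^ 4 = 1 → ∀ z ∈ Θ.source,
        (fun i => (![ε₀, 1, ε₂] : Fin 3 → ℂ) i * z i) ∈ Θ.source ∧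
        Θ (fun i => (![ε₀, 1, ε₂] : Fin 3 → ℂ) i * z i) = fun i => (![ε₀, 1, ε₂] : Fin 3 → ℂ) i * Θ z i) := by
  intro L hα hψ ht hs hn
  -- the coordinate map `(m, σ) ↦ L(σ/m³, m)` is analytic at `(m₀, 0)` with value `L(0, m₀)`
  set Lc : ℂ × ℂ → ℂ × ℂ := fun v => L (v.2 / v.1 ^ 3, v.1) with hLc
  have hL_an : ∀ v : ℂ × ℂ, AnalyticAt ℂ L v := by
    intro v
    refine AnalyticAt.prod ?_ ?_
    · exact ((analyticAt_const.mul (analyticAt_fst.sub analyticAt_const)).sub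
        (analyticAt_const.mul (analyticAt_snd.sub analyticAt_const))).div_const
    · exact ((analyticAt_const.mul (analyticAt_snd.sub analyticAt_const)).sub
        (analyticAt_const.mul (analyticAt_fst.sub analyticAt_const))).div_const
  have hLc_an : AnalyticAt ℂ Lc (m₀, 0) := by
    have hin : AnalyticAt ℂ (fun v : ℂ × ℂ => (v.2 / v.1 ^ 3, v.1)) (m₀, 0) :=
      (analyticAt_snd.div (analyticAt_fst.pow 3) (by simpa using pow_ne_zero 3 hm₀)).prod analyticAt_fst
    exact (hL_an _).comp hin
  have hLc0 : Lc (m₀, 0) = L (0, m₀) := by simp [hLc]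
  have hLc_slice : ∀ m, Lc (m, 0) = L (0, m) := fun m => by simp [hLc]
  -- the functions `A = 1/α∘Lc` and `G = ψ∘Lc`
  set A : ℂ × ℂ → ℂ := fun v => ((Lc v).1 - (Lc v).2)⁻¹ with hAdef
  set G : ℂ × ℂ → ℂ := fun v => ψ (Lc v) with hGdef
  have hαLc : AnalyticAt ℂ (fun v => (Lc v).1 - (Lc v).2) (m₀, 0) :=
    (analyticAt_fst.comp hLc_an).sub (analyticAt_snd.comp hLc_an)
  have hA : AnalyticAt ℂ A (m₀, 0) := hαLc.inv (by simpa [hLc0] using hα)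
  have hA0 : A (m₀, 0) ≠ 0 := by simpa [hAdef, hLc0] using inv_ne_zero hα
  have hG : AnalyticAt ℂ G (m₀, 0) := hψ.comp_of_eq hLc_an hLc0
  have hG1 : (fun m => G (m, 0)) = fun m => ψ (L (0, m)) := funext fun m => by simp [hGdef, hLc_slice]
  have h1 : deriv (fun m => G (m, 0)) m₀ = 0 := by rw [hG1]; exact ht
  have h2 : iteratedDeriv 2 (fun m => G (m, 0)) m₀ ≠ 0 := by rw [hG1]; exact hs
  have h3 : deriv (fun σ => G (m₀, σ)) 0 ≠ 0 := by
    have hG2 : (fun σ => G (m₀, σ)) = fun σ => (fun c => ψ (L (c, m₀))) (σ / m₀ ^ 3) := funext fun σ => by simp [hGdef, hLc]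
    rw [hG2]
    have hf : DifferentiableAt ℂ (fun c => ψ (L (c, m₀))) (0 / m₀ ^ 3) := by
      rw [zero_div]
      exact (hψ.comp_of_eq ((hL_an _).comp (analyticAt_id.prod analyticAt_const)) (by simp)).differentiableAt
    have hd : HasDerivAt (fun σ => (fun c => ψ (L (c, m₀))) (σ / m₀ ^ 3))
        ((m₀ ^ 3)⁻¹ • deriv (fun c => ψ (L (c, m₀))) (0 / m₀ ^ 3)) 0 := by
      have hi : HasDerivAt (fun σ : ℂ => σ / m₀ ^ 3) (m₀ ^ 3)⁻¹ 0 := by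
        simpa [div_eq_mul_inv] using (hasDerivAt_id (0 : ℂ)).mul_const (m₀ ^ 3)⁻¹
      exact hf.hasDerivAt.scomp 0 hi
    rw [hd.deriv, zero_div, smul_eq_mul]
    exact mul_ne_zero (inv_ne_zero (pow_ne_zero 3 hm₀)) hn
  obtain ⟨Θ, hz₀, hΘ0, hdiff, hcd, hcds, hNF, heq⟩ := exists_equivariantA3Chart hA hA0 hG h1 h2 h3
  refine ⟨Θ, hz₀, hΘ0, hdiff, hcd, hcds, fun z hz => ?_, heq⟩
  rw [hNF z hz]
  simp only [hAdef, hGdef, hLc, div_eq_mul_inv]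
  simp
  ring

end Literature.AlgebraicGeometry.HodgeTheory.Q8Family.BranchChart
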